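import Summits.FinalStateConjecture.FinalStateConjecture.Theorems.SwallowTheDatumBurialIntoShieldedBackgroundDebt

/-!
# Route `SwallowTheDatum` · item `BurialIntoShieldedBackground` (stmt-FinalStateConjecture-14721) —
# the item below the route's typed far-annulus gluing item `FarAnnulusGluing` (stmt-FinalStateConjecture-15427)

Since rev 9 of the route file the d-side analytic atom of the crux line `receding-annulus-universal-collar`
(registered stub `stub_farGluing` of the crux `ParametricKerrBurial`, stmt-FinalStateConjecture-10052) is a typed
route item of its own, `Theses.SwallowTheDatum.FarAnnulusGluing` (stmt-FinalStateConjecture-15427), with the line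
vocabulary `SmoothSectionsOn` / `AgreeAt` / `IsExactSchwarzschildBeyond`
(`Theorems/SwallowTheDatumParametricKerrBurialLine.lean`) inlined.  This file records, sorry-free:

* `farAnnulusGluing_iff_farGluing` : the route item IS the registered stub statement (A) — `Iff.rfl` (the three
  line definitions unfold syntactically to the inlined clauses);
* `parametricKerrBurial_of_farAnnulusGluing_of_collarDatum` : `FarAnnulusGluing` ⇒ universal collar (B) ⇒ the crux
  `ParametricKerrBurial` (the crux line's landed reduction `ParametricKerrBurial_of_farGluing_of_collarDatum`
  re-keyed to the route item);
* `of_farAnnulusGluing_of_relativeCollar` : `FarAnnulusGluing` ⇒ (`KerrShieldedDataExist` → (B)) ⇒ this item;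
* `of_farAnnulusGluing_of_collarDatum` : `FarAnnulusGluing` ⇒ (B) ⇒ this item.

So the cone of this item inside the route is now typed end to end: item 14721 ⇐ item 15427 (`FarAnnulusGluing`,
Mao–Oh–Tao arXiv:2308.13031 Thm 1.7/1.10 with smooth dependence on the gluing radius) ∧ (B) (`stub_collarDatum` of
item 10052: one admissible vacuum datum on `ℝ³`, exactly isotropic Schwarzschild(`μ`), `k = 0`, on `{1 < ‖y‖ < 2}`,
Kerr-shielded beyond radius `2`; it contains item 10055 `KerrShieldedDataExist`,
`kerrShieldedDataExist_of_collarDatum`).  Neither (A) nor (B) is claimed here.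

References: route file `Theses/SwallowTheDatum.lean` rev 9 (items 14721, 15427, 10052, 10055);
`Theorems/SwallowTheDatumBurialIntoShieldedBackgroundDebt.lean`; `Theorems/SwallowTheDatumParametricKerrBurialReduction.lean`;
Mao–Oh–Tao arXiv:2308.13031 Thm 1.7, Rem 1.9; Li–Mei arXiv:2005.01249 Thm 2.2.
-/

-- `Summit.<Summit>.<Problem>`: single-conjunct summit, the duplicate namespace component is mandated (CONVENTIONS §2).
set_option linter.dupNamespace false

namespace Summit.FinalStateConjecture.FinalStateConjecture.Theorems.SwallowTheDatum.BurialIntoShieldedBackground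

open scoped Manifold ContDiff Topology
open Bundle Set Function Literature.Geometry.Lorentzian
open Summit.FinalStateConjecture.FinalStateConjecture.Theses.SwallowTheDatum
  (ParametricKerrBurial KerrShieldedDataExist BurialIntoShieldedBackground FarAnnulusGluing)
open Summit.FinalStateConjecture.FinalStateConjecture.Theorems.SwallowTheDatum.ParametricKerrBurial
  (IsKerrShieldedAway IsSchwarzschildAnnulus IsExactSchwarzschildBeyond SmoothSectionsOn AgreeAt
    ParametricKerrBurial_of_farGluing_of_collarDatum)

/-- **The route item `FarAnnulusGluing` (stmt-FinalStateConjecture-15427) is verbatim the registered stub (A)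
`stub_farGluing` of the crux line**: `SmoothSectionsOn 𝓘(ℝ, ℝ) G s` is by definition the conjunction of the two
`ContMDiffOn` clauses of the route decl, `AgreeAt (G R) d x` the conjunction of the two section equalities, and
`IsExactSchwarzschildBeyond e (G R) (m R) (32 * R)` the exact-Schwarzschild clause, so the equivalence is `Iff.rfl`.
Mao–Oh–Tao arXiv:2308.13031 Thm 1.7 (content of (A)). [folklore] -/
theorem farAnnulusGluing_iff_farGluing :
    FarAnnulusGluing ↔
      (∀ (X : Type) [TopologicalSpace X] [ChartedSpace E3 X] [IsManifold (𝓡 3) ∞ X] [T2Space X]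
        [SecondCountableTopology X] [ConnectedSpace X], ∀ d ∈ admissibleVacuumData X,
        ∃ (η : ℝ) (e : AFEnd X) (Rstar : ℝ) (m : ℝ → ℝ) (G : ℝ → InitialDataSet (𝓡 3) X),
          0 < η ∧ e.IsSoleEnd ∧ e.R < Rstar ∧ ContDiff ℝ ∞ m ∧
          SmoothSectionsOn 𝓘(ℝ, ℝ) G {p : ℝ × X | Rstar < p.1} ∧
          ∀ R : ℝ, Rstar < R → G R ∈ admissibleVacuumData X ∧ (∀ x ∉ e.far R, AgreeAt (G R) d x) ∧
            η * R ≤ m R ∧ IsExactSchwarzschildBeyond e (G R) (m R) (32 * R)) :=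
  Iff.rfl

/-- **The crux from the route item `FarAnnulusGluing` and the universal collar (B)**: the crux line's landed
two-hypothesis reduction `ParametricKerrBurial_of_farGluing_of_collarDatum` (junction, collar dilation,
transport-and-patch, breathing, composition — all tree theorems) re-keyed to the typed route item.
Mao–Oh–Tao arXiv:2308.13031 Thm 1.7; Li–Mei arXiv:2005.01249 Thm 2.2 (content of the hypotheses). [folklore] -/
theorem parametricKerrBurial_of_farAnnulusGluing_of_collarDatum (hA : FarAnnulusGluing)
    (hB : ∀ [Kerr.Facts], ∀ μ₀ : ℝ, 0 < μ₀ → ∃ μ : ℝ, 0 < μ ∧ μ ≤ μ₀ ∧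
      ∃ C ∈ admissibleVacuumData E3, IsSchwarzschildAnnulus C μ ∧ IsKerrShieldedAway 2 C) :
    ParametricKerrBurial :=
  ParametricKerrBurial_of_farGluing_of_collarDatum (farAnnulusGluing_iff_farGluing.1 hA) hB

/-- **This item from the route item `FarAnnulusGluing` and the RELATIVE collar (B′)** (`KerrShieldedDataExist →`
the registered signature of `stub_collarDatum`): feed the item's hypothesis through (B′) and apply the re-keyed crux
reduction (`of_farGluing_of_relativeCollar`). [folklore] -/
theorem of_farAnnulusGluing_of_relativeCollar (hA : FarAnnulusGluing)
    (hB' : KerrShieldedDataExist →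
      ∀ [Kerr.Facts], ∀ μ₀ : ℝ, 0 < μ₀ → ∃ μ : ℝ, 0 < μ ∧ μ ≤ μ₀ ∧
        ∃ C ∈ admissibleVacuumData E3, IsSchwarzschildAnnulus C μ ∧ IsKerrShieldedAway 2 C) :
    BurialIntoShieldedBackground :=
  of_farGluing_of_relativeCollar (farAnnulusGluing_iff_farGluing.1 hA) hB'

/-- **This item from the route item `FarAnnulusGluing` and the universal collar (B)** (weakening of
`of_farAnnulusGluing_of_relativeCollar`; equivalently `of_parametricKerrBurial ∘
parametricKerrBurial_of_farAnnulusGluing_of_collarDatum`). [folklore] -/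
theorem of_farAnnulusGluing_of_collarDatum (hA : FarAnnulusGluing)
    (hB : ∀ [Kerr.Facts], ∀ μ₀ : ℝ, 0 < μ₀ → ∃ μ : ℝ, 0 < μ ∧ μ ≤ μ₀ ∧
      ∃ C ∈ admissibleVacuumData E3, IsSchwarzschildAnnulus C μ ∧ IsKerrShieldedAway 2 C) :
    BurialIntoShieldedBackground :=
  of_farAnnulusGluing_of_relativeCollar hA fun _ ↦ hB

end Summit.FinalStateConjecture.FinalStateConjecture.Theorems.SwallowTheDatum.BurialIntoShieldedBackground
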